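import Summits.NavierStokesRegularity.NavierStokesRegularity.Theorems.TerminalTraceTypeITraceScarL3NoConcentrationRegular
import Summits.NavierStokesRegularity.NavierStokesRegularity.Theorems.TerminalTraceTypeITraceScarL3TopSingularNull
import Summits.NavierStokesRegularity.NavierStokesRegularity.Theorems.TerminalTraceTypeITraceScarL3StrongExtinction
import Literature.Geometry.GeometricMeasureTheory.ContentCover

set_option linter.dupNamespace false

/-!
# NO LOCAL `L²` CONCENTRATION AT A TYPE-I BLOW-UP TIME (unit viscosity) — nsreg-C26-p1 g3
# (item `TerminalTrace.TypeITraceScarL3`, stmt-NavierStokesRegularity-18385; nsreg-p2 ROUND-33 seed s33-3)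

`localEnergy_sub_top_le_unit`: let `(u,p)` be classical on `[0,T) × ℝ³`, Leray–Hopf on `[0,T]` and
Type I in time at `T` (`‖u(t)‖_∞ ≤ C/√(T−t)` eventually), unit viscosity.  Then for EVERY `x₀` and
`R` and every `θ > 0` there is `t₀ < T` with `∫_{B(x₀,R)} |u(t) − u(T)|² ≤ θ` for all `t ∈ (t₀,T)`:
`u(t) → u(T)` in `L²_loc` STRONGLY — the blow-up does not concentrate energy, at singular points
included.  IN PRINT IN SUBSTANCE, in a stronger global form: Leslie–Shvydkoy, ARMA 230 (2018), Thm. 1.2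
(= arXiv:1705.04420): Type I in time ⇒ the ENERGY EQUALITY holds on the closed interval including the first
blow-up time, hence (Leray–Hopf weak continuity) `u(t) → u(T)` strongly in `L²(ℝ³)` — cf.
[cite: LeslieShvydkoy2017, Thm. 1.2].  The present file is a formal proof of the LOCAL statement by a
DIFFERENT route, which does not go through the energy equality (ROUND-33 §7 seed s33-3; director's label
correction DIRECTOR-NS #189 (1): known result, new formal route):

* the Type-I MORREY bound near `T` (`morrey_of_typeI`: `∫_{B(x,ρ)}|u(t)|² ≤ M ρ` for `t` close to
  `T`, `ρ ≤ r_M`, every centre) passes to the slice `u(T)` by weak lower semicontinuity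
  (`lintegral_ball_top_le_of_morrey`, Leray–Hopf weak continuity + Young);
* the top singular set `Σ_T = {x | (T,x) backward singular}` is closed and `ℋ¹`-NULL (CKN's Theorem B
  at the top slice, `hausdorffMeasure_topSingular_inBall_eq_zero`, applied to the Tao-gauged pair
  `(u,q)`, `isSuitableWeakSolutionInBall_gauged`), so `Σ_T ∩ B̄(x₀,R)` has finite covers by balls
  `B(xₙ,ρₙ)`, `ρₙ ≤ r_M`, with `Σ ρₙ` as small as we please (Federer 2.10.2,
  `exists_finset_ball_cover_of_hausdorffMeasure_lt`) — on which `∫|u(t) − u(T)|² ≤ 4M Σ ρₙ`;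
* the compact remainder consists of REGULAR top points, where `∫_{B(y,r)} |u(t) − u(T)|² → 0`
  (`localEnergy_sub_top_le_of_regular_unit`, part I); finitely many such balls suffice.

General viscosity and the `Tendsto` form are in `…NoConcentrationViscosity.lean`.
WHAT THIS IS NOT: a STRUCTURAL theorem about hypothetical Type-I blow-ups; it does not decide the
terminal-layer dial of ROUND-33 (exchange of limits), not 18385, NOT Navier–Stokes regularity.
-/

noncomputable section

open MeasureTheory Set Function Metric Filter Topology Literature.Analysis.FluidPDE
open scoped ENNReal NNReal RealInnerProductSpace

namespace Summit.NavierStokesRegularity.NavierStokesRegularity.Theorems.TypeITraceScarL3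

/-! ### The top singular set of the item's solution -/

/-- The backward-singular set at a fixed top time is closed (its complement is open: a bounded cylinder
at `(T,x)` contains the half-size cylinders at nearby points). [folklore] -/
theorem isClosed_topSingularSet_at (u : ℝ → EuclideanSpace ℝ (Fin 3) → EuclideanSpace ℝ (Fin 3)) (T : ℝ) :
    IsClosed {x : EuclideanSpace ℝ (Fin 3) |
      IsBackwardSingularPoint u ((T, x) : ℝ × EuclideanSpace ℝ (Fin 3))} := by
  rw [← isOpen_compl_iff, Metric.isOpen_iff]
  intro x hx
  have hx' : ¬ IsBackwardSingularPoint u ((T, x) : ℝ × EuclideanSpace ℝ (Fin 3)) := hx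
  simp only [IsBackwardSingularPoint, not_forall] at hx'
  obtain ⟨r, hr, hfin⟩ := hx'
  refine ⟨r / 2, half_pos hr, fun y hy hsing => ?_⟩
  have hsub : parabolicCylinder (r / 2) ((T, y) : ℝ × EuclideanSpace ℝ (Fin 3)) ⊆
      parabolicCylinder r ((T, x) : ℝ × EuclideanSpace ℝ (Fin 3)) := by
    rintro ⟨s, w⟩ hw
    rw [mem_parabolicCylinder] at hw ⊢
    obtain ⟨⟨hs1, hs2⟩, hwy⟩ := hw
    simp only at hs1 hs2 hwy ⊢
    refine ⟨⟨by nlinarith, hs2⟩, ?_⟩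
    calc dist w x ≤ dist w y + dist y x := dist_triangle _ _ _
      _ < r / 2 + r / 2 := add_lt_add hwy (mem_ball.1 hy)
      _ = r := by ring
  have hle := eLpNorm_mono_measure (uncurry u) (Measure.restrict_mono hsub (le_refl volume))
    (p := (⊤ : ℝ≥0∞))
  rw [hsing (r / 2) (half_pos hr)] at hle
  exact hfin (top_le_iff.1 hle)

/-- **The Tao-gauged pair is a suitable weak solution IN THE PARABOLIC BALL `Q_R(T,x₀)`** in
Albritton–Barker's sense (`IsSuitableWeakSolutionInBall`: suitable on the open cylinder, energy
clause, square-integrable weak gradient, pressure in `L^{3/2}`), for every `R` with `R² ≤ T`: the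
energy clause is the Leray–Hopf `L∞L²` bound, the gradient is the Leray–Hopf gradient restricted from
the strip, the pressure clause is Tao's gauge. [cite: AlbrittonBarker2019, Def. 2.1; Tao2011, Lemma 4.1 (i)] -/
theorem isSuitableWeakSolutionInBall_gauged {T : ℝ} (hT : 0 < T)
    {u : ℝ → EuclideanSpace ℝ (Fin 3) → EuclideanSpace ℝ (Fin 3)}
    {p : ℝ → EuclideanSpace ℝ (Fin 3) → ℝ}
    (hcl : IsClassicalNSSolutionOn (Ico 0 T) 1 0 u p) (hLH : IsLerayHopfOn T 1 0 (u 0) u)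
    (x₀ : EuclideanSpace ℝ (Fin 3)) {R : ℝ} (hRT : R ^ 2 ≤ T) :
    IsSuitableWeakSolutionInBall R ((T, x₀) : ℝ × EuclideanSpace ℝ (Fin 3)) u
      (fun t x => p t x - (p t 0 - normalisedPressure (u t) 0)) := by
  obtain ⟨hsw, hq⟩ := gaugedPressure_suitable_and_memLp one_pos hT hcl hLH x₀ hRT
  have hQslab := parabolicCylinder_top_subset_openSlab hRT x₀
  refine ⟨hsw, ?_, ?_, hq⟩
  · -- the energy clause from the Leray–Hopf `L∞L²` bound
    obtain ⟨C, hC⟩ := hLH.energy_bound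
    have hsubI : Ioo (((T, x₀) : ℝ × EuclideanSpace ℝ (Fin 3)).1 - R ^ 2) ((T, x₀) : ℝ × EuclideanSpace ℝ (Fin 3)).1
        ⊆ Ioo 0 T := by
      intro t ht
      simp only at ht
      exact ⟨by linarith [ht.1], ht.2⟩
    refine ⟨C, ?_⟩
    filter_upwards [ae_restrict_of_ae_restrict_of_subset hsubI hC] with t ht
    exact (setLIntegral_le_lintegral _ _).trans (by simpa [eEnergy] using ht)
  · -- the Leray–Hopf weak gradient restricted to the cylinder
    obtain ⟨G, hGslab, -, hGint, -⟩ := hLH.exists_hasWeakSpatialGradientOn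
    refine ⟨G, hGslab.mono (fun z hz => mem_slab.2 (mem_prod.1 (hQslab hz)).1), ?_⟩
    exact lt_of_le_of_lt (lintegral_mono_set hQslab) hGint

/-- **The top singular set of the item's solution meets every closed ball in an `ℋ¹`-null set**
(CKN's Theorem B at the top slice — `hausdorffMeasure_topSingular_inBall_eq_zero` — on the gauged pair
in the parabolic balls `Q_{√T}(T,k)` about a finite net `k` of the ball). [cite: Tsai1998, remark after Lemma 4.2 (p. 46); CaffarelliKohnNirenberg1982, Thm B] -/
theorem hausdorffMeasure_topSingularSet_inter_closedBall_eq_zero {T : ℝ} (hT : 0 < T)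
    {u : ℝ → EuclideanSpace ℝ (Fin 3) → EuclideanSpace ℝ (Fin 3)}
    {p : ℝ → EuclideanSpace ℝ (Fin 3) → ℝ}
    (hcl : IsClassicalNSSolutionOn (Ico 0 T) 1 0 u p) (hLH : IsLerayHopfOn T 1 0 (u 0) u)
    (x₀ : EuclideanSpace ℝ (Fin 3)) (R : ℝ) :
    μH[1] ({x : EuclideanSpace ℝ (Fin 3) |
      IsBackwardSingularPoint u ((T, x) : ℝ × EuclideanSpace ℝ (Fin 3))} ∩ closedBall x₀ R) = 0 := by
  set R₁ : ℝ := Real.sqrt T with hR₁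
  have hR₁pos : 0 < R₁ := Real.sqrt_pos.2 hT
  have hR₁T : R₁ ^ 2 ≤ T := (Real.sq_sqrt hT.le).le
  obtain ⟨net, -, hnetfin, hnetcov⟩ := finite_cover_balls_of_compact (isCompact_closedBall x₀ R) hR₁pos
  have hcov : {x : EuclideanSpace ℝ (Fin 3) |
      IsBackwardSingularPoint u ((T, x) : ℝ × EuclideanSpace ℝ (Fin 3))} ∩ closedBall x₀ R ⊆
      ⋃ k ∈ net, {x ∈ ball k R₁ |
        IsBackwardSingularPoint u ((T, x) : ℝ × EuclideanSpace ℝ (Fin 3))} := by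
    rintro x ⟨hx, hxR⟩
    obtain ⟨k, hk, hxk⟩ := mem_iUnion₂.1 (hnetcov hxR)
    exact mem_iUnion₂.2 ⟨k, hk, ⟨hxk, hx⟩⟩
  refine measure_mono_null hcov ((measure_biUnion_null_iff hnetfin.countable).2 fun k _ => ?_)
  exact hausdorffMeasure_topSingular_inBall_eq_zero hR₁pos
    (isSuitableWeakSolutionInBall_gauged hT hcl hLH k hR₁T)

/-! ### The Morrey bound passes to the top slice -/

/-- **The top slice inherits the Morrey bound** (weak lower semicontinuity, done with Young's
inequality): if `∫_{B(x₁,ρ)}|u(t)|² ≤ Mρ` for all `t ∈ (T₁,T)`, then `∫_{B(x₁,ρ)}|u(T)|² ≤ Mρ`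
(`t ↦ ∫⟪u(t), 1_B u(T)⟫` is continuous at `T` by the Leray–Hopf class, and
`⟪u(t), u(T)⟫ ≤ (|u(t)|² + |u(T)|²)/2`). [cite: Leray1934, §31] -/
theorem lintegral_ball_top_le_of_morrey {T : ℝ} (hT : 0 < T)
    {u : ℝ → EuclideanSpace ℝ (Fin 3) → EuclideanSpace ℝ (Fin 3)}
    (hLH : IsLerayHopfOn T 1 0 (u 0) u) {T₁ M ρ : ℝ} (hT₁ : T₁ < T) (hT₁0 : 0 ≤ T₁)
    (x₁ : EuclideanSpace ℝ (Fin 3))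
    (hmor : ∀ t ∈ Ioo T₁ T, ∫ x in ball x₁ ρ, ‖u t x‖ ^ 2 ≤ M * ρ) :
    ∫⁻ x in ball x₁ ρ, ‖u T x‖ₑ ^ 2 ≤ ENNReal.ofReal (M * ρ) := by
  have huT : MemLp (u T) 2 volume := hLH.memLp T ⟨hT.le, le_rfl⟩
  haveI hfinB : IsFiniteMeasure (volume.restrict (ball x₁ ρ)) :=
    isFiniteMeasure_restrict.2 measure_ball_lt_top.ne
  set E : ℝ := ∫ x in ball x₁ ρ, ‖u T x‖ ^ 2 with hE
  have hEint : Integrable (fun x => ‖u T x‖ ^ 2) (volume.restrict (ball x₁ ρ)) :=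
    (huT.restrict _).integrable_norm_pow two_ne_zero
  rw [lintegral_ball_enorm_sq_eq_ofReal huT x₁ ρ]
  refine ENNReal.ofReal_le_ofReal ?_
  -- the pairing with `w = 1_B u(T)`
  set w : EuclideanSpace ℝ (Fin 3) → EuclideanSpace ℝ (Fin 3) := (ball x₁ ρ).indicator (u T) with hw
  have hwmem : MemLp w 2 volume := huT.indicator measurableSet_ball
  set G : ℝ → ℝ := fun s => ∫ x, ⟪u s x, w x⟫ with hG
  have hGcont : ContinuousWithinAt G (Ioc 0 T) T := (hLH.weak_continuous w hwmem).1 T ⟨hT, le_rfl⟩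
  have hIoc : Ioo T₁ T ⊆ Ioc 0 T := fun s hs => ⟨hT₁0.trans_lt hs.1, hs.2.le⟩
  have hGlim : Tendsto G (𝓝[<] T) (𝓝 (G T)) := by
    have h1 : Tendsto G (𝓝[Ioo T₁ T] T) (𝓝 (G T)) := hGcont.mono hIoc
    rwa [nhdsWithin_Ioo_eq_nhdsLT hT₁] at h1
  have hGball : ∀ s ∈ Icc 0 T, G s = ∫ x in ball x₁ ρ, ⟪u s x, u T x⟫ := by
    intro s hs
    rw [hG]
    simp only
    have e1 : (fun x => ⟪u s x, w x⟫) = (ball x₁ ρ).indicator (fun x => ⟪u s x, u T x⟫) := by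
      funext x
      by_cases hx : x ∈ ball x₁ ρ
      · rw [hw, indicator_of_mem hx, indicator_of_mem hx]
      · rw [hw, indicator_of_notMem hx, indicator_of_notMem hx, inner_zero_right]
    rw [e1, integral_indicator measurableSet_ball]
  have hGT : G T = E := by
    rw [hGball T ⟨hT.le, le_rfl⟩, hE]
    refine integral_congr_ae (ae_of_all _ fun x => ?_)
    simp only
    rw [real_inner_self_eq_norm_sq]
  -- Young on `(T₁, T)`: `G s ≤ (Mρ + E)/2`
  have hyoung : ∀ s ∈ Ioo T₁ T, G s ≤ (M * ρ + E) / 2 := by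
    intro s hs
    have hsIcc : s ∈ Icc 0 T := ⟨hT₁0.trans hs.1.le, hs.2.le⟩
    have hus : MemLp (u s) 2 volume := hLH.memLp s hsIcc
    rw [hGball s hsIcc]
    have hint1 : Integrable (fun x => ⟪u s x, u T x⟫) (volume.restrict (ball x₁ ρ)) :=
      (integrable_inner_of_memLp_two hus huT).restrict
    have hsint : Integrable (fun x => ‖u s x‖ ^ 2) (volume.restrict (ball x₁ ρ)) :=
      (hus.restrict _).integrable_norm_pow two_ne_zero
    have hint2 : Integrable (fun x => ‖u s x‖ ^ 2 / 2 + ‖u T x‖ ^ 2 / 2) (volume.restrict (ball x₁ ρ)) :=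
      (hsint.div_const 2).add (hEint.div_const 2)
    calc ∫ x in ball x₁ ρ, ⟪u s x, u T x⟫
        ≤ ∫ x in ball x₁ ρ, (‖u s x‖ ^ 2 / 2 + ‖u T x‖ ^ 2 / 2) := by
          refine setIntegral_mono_on hint1 hint2 measurableSet_ball fun x _ => ?_
          have h1 : ⟪u s x, u T x⟫ ≤ ‖u s x‖ * ‖u T x‖ := real_inner_le_norm _ _
          nlinarith [sq_nonneg (‖u s x‖ - ‖u T x‖)]
      _ = (∫ x in ball x₁ ρ, ‖u s x‖ ^ 2) / 2 + E / 2 := by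
          rw [integral_add (hsint.div_const 2) (hEint.div_const 2), integral_div, integral_div, ← hE]
      _ ≤ (M * ρ + E) / 2 := by linarith [hmor s hs]
  have hev : ∀ᶠ s in 𝓝[<] T, G s ≤ (M * ρ + E) / 2 := by
    rw [← nhdsWithin_Ioo_eq_nhdsLT hT₁]
    exact eventually_nhdsWithin_of_forall fun s hs => hyoung s hs
  have hle : E ≤ (M * ρ + E) / 2 := by
    have := le_of_tendsto hGlim hev
    rwa [hGT] at this
  linarith

/-! ### Finitely many final intervals have a common one -/

/-- If each of finitely many conditions holds on some final interval `(t_i, T)`, then all of them hold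
on a common final interval. [folklore] -/
theorem exists_lt_forall_Ioo_finset {ι : Type*} (I : Finset ι) {T : ℝ} {p : ι → ℝ → Prop}
    (h : ∀ i ∈ I, ∃ t₀ : ℝ, t₀ < T ∧ ∀ t ∈ Ioo t₀ T, p i t) :
    ∃ t₀ : ℝ, t₀ < T ∧ ∀ t ∈ Ioo t₀ T, ∀ i ∈ I, p i t := by
  classical
  induction I using Finset.induction_on with
  | empty => exact ⟨T - 1, by linarith, fun _ _ _ hi => by simp at hi⟩
  | insert j I hj ih =>
    obtain ⟨s₁, hs₁, h₁⟩ := h j (Finset.mem_insert_self _ _)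
    obtain ⟨s₂, hs₂, h₂⟩ := ih fun i hi => h i (Finset.mem_insert_of_mem hi)
    refine ⟨max s₁ s₂, max_lt hs₁ hs₂, fun t ht i hi => ?_⟩
    rcases Finset.mem_insert.1 hi with rfl | hi
    · exact h₁ t ⟨(le_max_left _ _).trans_lt ht.1, ht.2⟩
    · exact h₂ t ⟨(le_max_right _ _).trans_lt ht.1, ht.2⟩ i hi

/-! ### The theorem -/

/-- Pointwise: `‖a − b‖ₑ² ≤ 2‖a‖ₑ² + 2‖b‖ₑ²`. [folklore] -/
theorem enorm_sub_sq_le (a b : EuclideanSpace ℝ (Fin 3)) :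
    ‖a - b‖ₑ ^ 2 ≤ 2 * ‖a‖ₑ ^ 2 + 2 * ‖b‖ₑ ^ 2 := by
  have h : ‖a - b‖ ^ 2 ≤ 2 * ‖a‖ ^ 2 + 2 * ‖b‖ ^ 2 := by
    nlinarith [norm_sub_le a b, norm_nonneg a, norm_nonneg b, norm_nonneg (a - b),
      sq_nonneg (‖a‖ - ‖b‖)]
  calc ‖a - b‖ₑ ^ 2 = ENNReal.ofReal (‖a - b‖ ^ 2) := by
        rw [← ofReal_norm, ENNReal.ofReal_pow (norm_nonneg _)]
    _ ≤ ENNReal.ofReal (2 * ‖a‖ ^ 2 + 2 * ‖b‖ ^ 2) := ENNReal.ofReal_le_ofReal h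
    _ = 2 * ‖a‖ₑ ^ 2 + 2 * ‖b‖ₑ ^ 2 := by
        rw [ENNReal.ofReal_add (by positivity) (by positivity), ENNReal.ofReal_mul zero_le_two,
          ENNReal.ofReal_mul zero_le_two, ENNReal.ofReal_pow (norm_nonneg _),
          ENNReal.ofReal_pow (norm_nonneg _), ofReal_norm, ofReal_norm, ENNReal.ofReal_ofNat]

/-- **NO LOCAL `L²` CONCENTRATION AT A TYPE-I BLOW-UP TIME (unit viscosity)** (module docstring).
For `(u,p)` classical on `[0,T)`, Leray–Hopf on `[0,T]`, Type I in time at `T`: for every centre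
`x₀`, radius `R` and `θ > 0` there is `t₀ < T` with `∫_{B(x₀,R)} |u(t) − u(T)|² ≤ θ` for all
`t ∈ (t₀, T)`.  Morrey bound of the rate + `ℋ¹`-nullity of the top singular set (CKN at the top, on the
gauged pair) + Federer covers + the regular-point convergence of part I.  Known in substance in global
form: Leslie–Shvydkoy 2018, Thm. 1.2 (energy equality including the Type-I blow-up time); this is a formal
proof of the local statement by a different route.
[cite: LeslieShvydkoy2017, Thm. 1.2; CaffarelliKohnNirenberg1982, Thm B; Federer1969, 2.10.2; AlbrittonBarker2019, Lemma 2.5; Tao2011, Lemma 4.1 (i)] -/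
theorem localEnergy_sub_top_le_unit {T : ℝ} (hT : 0 < T)
    {u : ℝ → EuclideanSpace ℝ (Fin 3) → EuclideanSpace ℝ (Fin 3)}
    {p : ℝ → EuclideanSpace ℝ (Fin 3) → ℝ}
    (hcl : IsClassicalNSSolutionOn (Ico 0 T) 1 0 u p) (hLH : IsLerayHopfOn T 1 0 (u 0) u)
    (hTI : IsTypeIBlowup u T) (x₀ : EuclideanSpace ℝ (Fin 3)) (R : ℝ) {θ : ℝ} (hθ : 0 < θ) :
    ∃ t₀ : ℝ, t₀ < T ∧ ∀ t ∈ Ioo t₀ T,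
      ∫⁻ z in ball x₀ R, ‖u t z - u T z‖ₑ ^ 2 ≤ ENNReal.ofReal θ := by
  classical
  -- ### the Type-I Morrey bound near `T`, about every centre
  obtain ⟨rM, M₀, TM, hrM, hTM, hmorB⟩ := morrey_of_typeI one_pos hT hcl hLH hTI
  set M : ℝ := max M₀ 0 with hM_def
  have hM0 : 0 ≤ M := le_max_right _ _
  set T₁ : ℝ := max TM (T / 2) with hT₁
  have hT₁T : T₁ < T := max_lt hTM (by linarith)
  have hT₁0 : 0 ≤ T₁ := le_trans (by linarith) (le_max_right _ _)
  have hmor : ∀ t ∈ Ioo T₁ T, ∀ (x₁ : EuclideanSpace ℝ (Fin 3)) (r : ℝ), 0 < r → r ≤ rM →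
      ∫ x in ball x₁ r, ‖u t x‖ ^ 2 ≤ M * r := by
    intro t ht x₁ r hr hrr
    have ht' : t ∈ Ioo TM T := ⟨(le_max_left _ _).trans_lt ht.1, ht.2⟩
    exact (hmorB t ht' x₁ r hr hrr).trans (mul_le_mul_of_nonneg_right (le_max_left _ _) hr.le)
  have hmorE : ∀ t ∈ Ioo T₁ T, ∀ (x₁ : EuclideanSpace ℝ (Fin 3)) (r : ℝ), 0 < r → r ≤ rM →
      ∫⁻ x in ball x₁ r, ‖u t x‖ₑ ^ 2 ≤ ENNReal.ofReal (M * r) := by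
    intro t ht x₁ r hr hrr
    rw [lintegral_ball_enorm_sq_eq_ofReal (hLH.memLp t ⟨hT₁0.trans ht.1.le, ht.2.le⟩)]
    exact ENNReal.ofReal_le_ofReal (hmor t ht x₁ r hr hrr)
  have hmorT : ∀ (x₁ : EuclideanSpace ℝ (Fin 3)) (r : ℝ), 0 < r → r ≤ rM →
      ∫⁻ x in ball x₁ r, ‖u T x‖ₑ ^ 2 ≤ ENNReal.ofReal (M * r) := fun x₁ r hr hrr =>
    lintegral_ball_top_le_of_morrey hT hLH hT₁T hT₁0 x₁ fun t ht => hmor t ht x₁ r hr hrr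
  -- ### the compact `ℋ¹`-null top singular set in the closed ball and its small cover
  set Sing : Set (EuclideanSpace ℝ (Fin 3)) := {x : EuclideanSpace ℝ (Fin 3) |
    IsBackwardSingularPoint u ((T, x) : ℝ × EuclideanSpace ℝ (Fin 3))} with hSing
  have hKc : IsCompact (Sing ∩ closedBall x₀ R) :=
    (isCompact_closedBall x₀ R).of_isClosed_subset
      ((isClosed_topSingularSet_at u T).inter isClosed_closedBall) inter_subset_right
  have hK0 : μH[1] (Sing ∩ closedBall x₀ R) = 0 :=
    hausdorffMeasure_topSingularSet_inter_closedBall_eq_zero hT hcl hLH x₀ R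
  have hγpos : 0 < ENNReal.ofReal (θ / (64 * (M + 1))) := by
    rw [ENNReal.ofReal_pos]; positivity
  have hγlt : μH[1] (Sing ∩ closedBall x₀ R) < ENNReal.ofReal (θ / (64 * (M + 1))) := by
    rw [hK0]; exact hγpos
  obtain ⟨S, x, ρ, hρ, hKcov, hsum⟩ :=
    Literature.Geometry.GeometricMeasureTheory.exists_finset_ball_cover_of_hausdorffMeasure_lt
      one_pos hKc hγlt ENNReal.ofReal_ne_top hrM
  have h4 : (2 : ℝ≥0∞) ^ ((1 : ℝ) + 1) = 4 := by
    rw [show ((1 : ℝ) + 1) = ((2 : ℕ) : ℝ) by norm_num, ENNReal.rpow_natCast]; norm_num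
  have hsum' : ∑ n ∈ S, ENNReal.ofReal (ρ n) ≤ 8 * ENNReal.ofReal (θ / (64 * (M + 1))) := by
    have h1 : ∑ n ∈ S, ENNReal.ofReal (ρ n) = ∑ n ∈ S, ENNReal.ofReal (ρ n) ^ (1 : ℝ) := by
      simp only [ENNReal.rpow_one]
    rw [h1]
    refine hsum.trans (le_of_eq ?_)
    rw [h4, ← mul_assoc]
    norm_num
  -- energy of `u(t) − u(T)` on the singular cover: `≤ 4M Σ ρₙ ≤ θ/2`
  have hcoverE : ∀ t ∈ Ioo T₁ T,
      ∑ n ∈ S, ∫⁻ z in ball (x n) (ρ n), ‖u t z - u T z‖ₑ ^ 2 ≤ ENNReal.ofReal (θ / 2) := by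
    intro t ht
    have hball : ∀ n ∈ S, ∫⁻ z in ball (x n) (ρ n), ‖u t z - u T z‖ₑ ^ 2 ≤
        ENNReal.ofReal (4 * M) * ENNReal.ofReal (ρ n) := by
      intro n hn
      have hρn := hρ n hn
      have htIcc : t ∈ Icc 0 T := ⟨hT₁0.trans ht.1.le, ht.2.le⟩
      have hmeas : AEMeasurable (fun z => 2 * ‖u t z‖ₑ ^ 2) (volume.restrict (ball (x n) (ρ n))) :=
        ((((hLH.memLp t htIcc).aestronglyMeasurable.aemeasurable.enorm.pow_const 2).const_mul 2)).restrict
      have hMρ : 0 ≤ M * ρ n := mul_nonneg hM0 hρn.1.le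
      calc ∫⁻ z in ball (x n) (ρ n), ‖u t z - u T z‖ₑ ^ 2
          ≤ ∫⁻ z in ball (x n) (ρ n), (2 * ‖u t z‖ₑ ^ 2 + 2 * ‖u T z‖ₑ ^ 2) :=
            lintegral_mono fun z => enorm_sub_sq_le _ _
        _ = (2 * ∫⁻ z in ball (x n) (ρ n), ‖u t z‖ₑ ^ 2) + 2 * ∫⁻ z in ball (x n) (ρ n), ‖u T z‖ₑ ^ 2 := by
            rw [lintegral_add_left' hmeas, lintegral_const_mul' _ _ ENNReal.ofNat_ne_top,
              lintegral_const_mul' _ _ ENNReal.ofNat_ne_top]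
        _ ≤ 2 * ENNReal.ofReal (M * ρ n) + 2 * ENNReal.ofReal (M * ρ n) := by
            gcongr
            · exact hmorE t ht (x n) (ρ n) hρn.1 hρn.2
            · exact hmorT (x n) (ρ n) hρn.1 hρn.2
        _ = ENNReal.ofReal (4 * M) * ENNReal.ofReal (ρ n) := by
            rw [show (2 : ℝ≥0∞) = ENNReal.ofReal 2 by norm_num, ← ENNReal.ofReal_mul (by norm_num),
              ← ENNReal.ofReal_add (by positivity) (by positivity), ← ENNReal.ofReal_mul (by positivity)]
            congr 1
            ring
    calc ∑ n ∈ S, ∫⁻ z in ball (x n) (ρ n), ‖u t z - u T z‖ₑ ^ 2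
        ≤ ∑ n ∈ S, ENNReal.ofReal (4 * M) * ENNReal.ofReal (ρ n) := Finset.sum_le_sum hball
      _ = ENNReal.ofReal (4 * M) * ∑ n ∈ S, ENNReal.ofReal (ρ n) := by rw [Finset.mul_sum]
      _ ≤ ENNReal.ofReal (4 * M) * (8 * ENNReal.ofReal (θ / (64 * (M + 1)))) := by
          gcongr
      _ = ENNReal.ofReal (4 * M * (8 * (θ / (64 * (M + 1))))) := by
          rw [show (8 : ℝ≥0∞) = ENNReal.ofReal 8 by norm_num, ← ENNReal.ofReal_mul (by norm_num),
            ← ENNReal.ofReal_mul (by positivity)]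
      _ ≤ ENNReal.ofReal (θ / 2) := by
          refine ENNReal.ofReal_le_ofReal ?_
          have hMpos : 0 < M + 1 := by positivity
          rw [show 4 * M * (8 * (θ / (64 * (M + 1)))) = (M / (M + 1)) * (θ / 2) by field_simp; ring]
          have hle : M / (M + 1) ≤ 1 := by rw [div_le_one hMpos]; linarith
          nlinarith [hle, hθ, div_nonneg hM0 hMpos.le]
  -- ### the compact regular remainder and its finite cover by regular balls
  have hOo : IsOpen (⋃ n ∈ S, ball (x n) (ρ n)) := isOpen_biUnion fun _ _ => isOpen_ball
  have hK'c : IsCompact (closedBall x₀ R \ ⋃ n ∈ S, ball (x n) (ρ n)) :=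
    (isCompact_closedBall _ _).diff hOo
  have hreg : ∀ y ∈ closedBall x₀ R \ ⋃ n ∈ S, ball (x n) (ρ n),
      ∃ r : ℝ, 0 < r ∧ ∀ θ' : ℝ, 0 < θ' → ∃ t₀ : ℝ, t₀ < T ∧ ∀ t ∈ Ioo t₀ T,
        ∫⁻ z in ball y r, ‖u t z - u T z‖ₑ ^ 2 ≤ ENNReal.ofReal θ' := by
    rintro y ⟨hyR, hyO⟩
    refine localEnergy_sub_top_le_of_regular_unit hT hcl hLH fun hsing => ?_
    exact hyO (hKcov ⟨hsing, hyR⟩)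
  choose! rr hrr hθy using hreg
  obtain ⟨Tf, hTsub, hTcov⟩ : ∃ Tf : Finset (EuclideanSpace ℝ (Fin 3)),
      (↑Tf : Set (EuclideanSpace ℝ (Fin 3))) ⊆ closedBall x₀ R \ ⋃ n ∈ S, ball (x n) (ρ n) ∧
      closedBall x₀ R \ ⋃ n ∈ S, ball (x n) (ρ n) ⊆ ⋃ y ∈ Tf, ball y (rr y) := by
    obtain ⟨b', hb'sub, hb'fin, hb'cov⟩ := hK'c.elim_finite_subcover_image
      (b := closedBall x₀ R \ ⋃ n ∈ S, ball (x n) (ρ n))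
      (c := fun y => ball y (rr y)) (fun _ _ => isOpen_ball)
      (fun y hy => mem_biUnion hy (mem_ball_self (hrr y hy)))
    refine ⟨hb'fin.toFinset, by rwa [Set.Finite.coe_toFinset], ?_⟩
    simpa only [Set.Finite.mem_toFinset] using hb'cov
  have hθ₁pos : 0 < θ / (2 * ((Tf.card : ℝ) + 1)) := by positivity
  obtain ⟨t₂, ht₂, hRegular⟩ : ∃ t₂ : ℝ, t₂ < T ∧ ∀ t ∈ Ioo t₂ T, ∀ y ∈ Tf,
      ∫⁻ z in ball y (rr y), ‖u t z - u T z‖ₑ ^ 2 ≤ ENNReal.ofReal (θ / (2 * ((Tf.card : ℝ) + 1))) :=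
    exists_lt_forall_Ioo_finset Tf fun y hy => hθy y (hTsub hy) _ hθ₁pos
  refine ⟨max T₁ t₂, max_lt hT₁T ht₂, fun t ht => ?_⟩
  have htT₁ : t ∈ Ioo T₁ T := ⟨(le_max_left _ _).trans_lt ht.1, ht.2⟩
  have htt₂ : t ∈ Ioo t₂ T := ⟨(le_max_right _ _).trans_lt ht.1, ht.2⟩
  -- ### assemble
  have hballsub : ball x₀ R ⊆ (⋃ n ∈ S, ball (x n) (ρ n)) ∪ ⋃ y ∈ Tf, ball y (rr y) := by
    intro z hz
    by_cases hzO : z ∈ ⋃ n ∈ S, ball (x n) (ρ n)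
    · exact Or.inl hzO
    · exact Or.inr (hTcov ⟨ball_subset_closedBall hz, hzO⟩)
  have hcard : (Tf.card : ℝ≥0∞) * ENNReal.ofReal (θ / (2 * ((Tf.card : ℝ) + 1))) ≤
      ENNReal.ofReal (θ / 2) := by
    rw [← ENNReal.ofReal_natCast, ← ENNReal.ofReal_mul (Nat.cast_nonneg _)]
    refine ENNReal.ofReal_le_ofReal ?_
    have h2 : 0 < 2 * ((Tf.card : ℝ) + 1) := by positivity
    rw [← mul_div_assoc, div_le_iff₀ h2]
    nlinarith [hθ, Nat.cast_nonneg (α := ℝ) Tf.card]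
  calc ∫⁻ z in ball x₀ R, ‖u t z - u T z‖ₑ ^ 2
      ≤ ∫⁻ z in (⋃ n ∈ S, ball (x n) (ρ n)) ∪ ⋃ y ∈ Tf, ball y (rr y), ‖u t z - u T z‖ₑ ^ 2 :=
        lintegral_mono_set hballsub
    _ ≤ (∫⁻ z in ⋃ n ∈ S, ball (x n) (ρ n), ‖u t z - u T z‖ₑ ^ 2) +
          ∫⁻ z in ⋃ y ∈ Tf, ball y (rr y), ‖u t z - u T z‖ₑ ^ 2 := lintegral_union_le _ _ _
    _ ≤ (∑ n ∈ S, ∫⁻ z in ball (x n) (ρ n), ‖u t z - u T z‖ₑ ^ 2) +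
          ∑ y ∈ Tf, ∫⁻ z in ball y (rr y), ‖u t z - u T z‖ₑ ^ 2 :=
        add_le_add (lintegral_biUnion_finset_le _ _ _ _) (lintegral_biUnion_finset_le _ _ _ _)
    _ ≤ ENNReal.ofReal (θ / 2) + ∑ _y ∈ Tf, ENNReal.ofReal (θ / (2 * ((Tf.card : ℝ) + 1))) :=
        add_le_add (hcoverE t htT₁) (Finset.sum_le_sum (hRegular t htt₂))
    _ = ENNReal.ofReal (θ / 2) + (Tf.card : ℝ≥0∞) * ENNReal.ofReal (θ / (2 * ((Tf.card : ℝ) + 1))) := by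
        rw [Finset.sum_const, nsmul_eq_mul]
    _ ≤ ENNReal.ofReal (θ / 2) + ENNReal.ofReal (θ / 2) := add_le_add le_rfl hcard
    _ = ENNReal.ofReal θ := by
        rw [← ENNReal.ofReal_add (by positivity) (by positivity), add_halves]

end Summit.NavierStokesRegularity.NavierStokesRegularity.Theorems.TypeITraceScarL3

end
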